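/-
Copyright: cell pub-balaban-gaps (YM BLITZ Y1, track G1), seat g1-p2 GEN 6 (unit `pub-balaban-gaps-g1-p2`).  Row (D4) NODE O,
OBJECT ∕ MECHANISM level: the EXPONENTIAL-TAIL step of the block road.  HONEST FRAMING: bookkeeping over hypothesis SHAPES and the
landed block calculus (files 33–42 of this seat); nothing of Bałaban's constructed or asserted; (D4) NOT discharged (instance 0∕1);
NOT BetaPertH, NOT continuum, NOT Clay.
-/
import Summits.QuantumFields.BalabanUV.Gaps.D4WalkBlockGlue

/-!
# `Gaps.D4WalkBlockTail` — a block walk expansion survives an exponentially-tailed perturbation of the operator: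
# `W ↦ W·(1 + V·W)⁻¹`, margin `O(λ_V)`, and at `s ≡ 1` the kernel is `(A + V)⁻¹` (cell pub-balaban-gaps, seat g1-p2 GEN 6)

HONEST DEPENDENCY (cell pub-balaban, verbatim): continuum YM on T⁴ ⇐ BetaPertH ∧ nine spine estimates (0/9 proved);
BetaPertH ⇐ (D1) ∧ (D4) ∧ CAP+tail.

WHY.  The seat's one-scale ENDs with the local inverses constructed (`Gaps/D4WalkBlockLocalInverse.blockWalkExpansion_accretive`,
`Gaps/D4WalkBlockAccretiveDecay.blockWalkExpansion_accretive_print`) ask the packaging letter `hKrange` — `Δ′(u) = 1 + K′(u)` of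
FINITE range `r₁` — because the commutator steps `[h_□, K′]G′_□h_□` must be domain-local.  Bałaban's unit-lattice operators are NOT of
finite range: the kernel of [B9] Thm 3.2 (3.48) p. 398, `|(Q′(U)G′²(U)Q′*(U)f)(y,y′)| ≤ B₀(L^jη)^{−2}…e^{−δ₀|y−y′|}`, has exponential
TAILS (the located residue of RESIDUE (D4) v1.15, rows V62 (2) ∕ V67 J47-1: «the tail split `K′ = K′_{≤r₁} + K′_tail` NOT ATTEMPTED»).
Print's own device for a small remainder on top of an expansion already in hand is the resolvent series: p. 411 (3.95)–(3.96)
*«(Q′G′²Q′*)⁻¹ = C₀(I − R)⁻¹ = Σ_{n≥0} C₀Rⁿ … This expansion is unsatisfactory yet, because it is expressed in terms of the unlocalized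
operator G.  To get an expansion having the desired properties we replace the operator G everywhere in the series (3.96) by an expansion
similar to (3.90)»* and p. 421–422 (3.130) *«G = G₀ Σ_{n≥0} (−Δ′_π G₀)ⁿ … Of course Theorem 3.10 holds also because we replace each
operator in (3.130) by its random walk expansion.  We do not have problems now with operators without small factors, because each
operator Δ′_π provides the small factor α₀»* ([II] (1.11) p. 5 for the uniformity of the walk bounds on the polydisc `|s| ≤ e^{κ₁}`).
THIS FILE is that step in the BLOCK currency, abstractly: split `Δ′ = A + V` with `A` the part whose decorated expansion `W(s,u)` is in
hand (for the seat's ENDs: the finite-range part) and `V` the perturbation — the tail, or print's `Δ′_π` —, a σ-INDEPENDENT holomorphic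
family with ONE decaying block letter
`‖V(u)‖_{y,y′} ≤ λ_V e^{−ρ_V d₁(y,y′)}`; then `W(s,u)·(1 + V(u)W(s,u))⁻¹` is again a `BlockWalkExpansion` (GEN 4's product ∕ Neumann
steps BY NAME: `blockWalkExpansion_mul`, `blockWalkExpansion_inv_pencil`, `blockWalkExpansion_one`), with margin
`q = c_μ(c_μ(c_μλ_VK̄_Wc_μ)c_μ)c_μ < 1` — "the tail is small", i.e. `r₁` sufficiently large at fixed rates — and NO new
`e^{κ₁·}` price (every factor is bounded on the whole polydisc already); and at `s ≡ 1`, where `W(1,u) = A(u)⁻¹`, the new kernel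
IS `(A(u) + V(u))⁻¹ = Δ′(u)⁻¹`.
* §1 `blockWalkExpansion_congr_kernel` (pointwise-equal kernels), `blockNorm_kernel_le` (the BLOCK twin of
  `B13JointWalkExpansion.JointWalkExpansion.majorants`: the expanded kernel itself has blocks `≤ K̄e^{−κd₁}`);
* §2 `blockWalkExpansion_single` (a σ-independent holomorphic family with a decaying block letter is its own one-term expansion);
* §3 `blockWalkExpansion_tail_bwe` (THE STEP for a block-walk-expanded, possibly s-decorated perturbation: rates drop by `2μ`, constant
  `c_μK̄_W(1−q)⁻¹c_μ`) and `blockWalkExpansion_tail` (the σ-independent tail with ONE decaying block letter, via §2);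
* §4 `tail_kernel_one` (`W(1,u) = A(u)⁻¹` as a right inverse and `1 + V(u)W(1,u)` a unit ⟹ the `s ≡ 1` kernel is `(A(u)+V(u))⁻¹`).
The `hunit` letter of §4 is discharged from the margin in the successor file (Gershgorin, as `Gaps/D4WalkBlockStepUnit` does for
the parametrix); the composition with the seat's ENDs (the tail-tolerant twin of `blockWalkExpansion_accretive_print`) likewise.
Value: kernel-checked bookkeeping; nothing of Bałaban's asserted; words of row (D4) UNCHANGED.

References: T. Bałaban, Comm. Math. Phys. 99 (1985) 389–434 [B9], Thm 3.2 (3.48) p.398, (3.92)–(3.94) p.410, (3.95)–(3.96)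
p.411, Thm 3.10 (3.107)–(3.108) p.416, (3.130) p.421, p.422; Comm. Math. Phys. 116 (1988) 1–22 [II], (1.11) p.5, p.13, p.15.
-/

noncomputable section

namespace Summit.QuantumFields.BalabanUV.Gaps.D4WalkBlockTail

open Metric Set Finset
open Literature.MathematicalPhysics.QuantumFieldTheory.Balaban1983to89
open Literature.MathematicalPhysics.QuantumFieldTheory.Balaban1983to89.B9SectDWalk (Through MajSumLe DomBy infConv chainDist)
open Literature.MathematicalPhysics.QuantumFieldTheory.Balaban1983to89.B9Thm34Ext (toB6)
open Literature.MathematicalPhysics.QuantumFieldTheory.Balaban1983to89.B9Thm37GlueTorus (torusGeom tdist1 tdist1_nonneg)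
open Literature.MathematicalPhysics.QuantumFieldTheory.Balaban1983to89.TreeLengthTorus (TPt)
open Literature.MathematicalPhysics.QuantumFieldTheory.Balaban1983to89.B5TorusCover (UT)
open Literature.MathematicalPhysics.QuantumFieldTheory.Balaban1983to89.B11SectG (RowSum)
open Summit.QuantumFields.BalabanUV.Gaps.D4WalkBlock
  (rowMass blockNorm blockNorm_nonneg rowMass_le_blockNorm norm_entry_le_blockNorm blockNorm_le_of_rowMass_le BlockWalkExpansion)
open Summit.QuantumFields.BalabanUV.Gaps.D4WalkProduct (domBy_infConv_torus)
open Summit.QuantumFields.BalabanUV.Gaps.D4WalkNeumann (domBy_chain)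
open Summit.QuantumFields.BalabanUV.Gaps.D4WalkBlockProduct (blockWalkExpansion_mul)
open Summit.QuantumFields.BalabanUV.Gaps.D4WalkBlockNeumann (blockWalkExpansion_inv_pencil)
open Summit.QuantumFields.BalabanUV.Gaps.D4WalkBlockGlue (blockWalkExpansion_one)

variable {ν : ℕ} {K : Fin ν → ℕ} [∀ i, NeZero (K i)]
variable {d N' : ℕ} {p n : Type} [Fintype p] [Fintype n]
variable {E : Type*} [NormedAddCommGroup E] [NormedSpace ℂ E]

/-! ## §1. Two projections of the shape: pointwise-equal kernels; the block bound of the expanded kernel itself -/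

section Projections

variable {c : B13.Consts} {cub : p → UT K} {cubn : n → UT K} {K2 K2' : (TPt d N' → ℂ) → E → Matrix p n ℂ}
variable {X : Finset (UT K)} {R ε kap Kbar : ℝ}
variable {W : Type} {T2 : W → (TPt d N' → ℂ) → E → Matrix p n ℂ} {SX : Set W} {A : W → ℝ}
variable {D : W → UT K → UT K → ℝ} {ρ : ℝ}

/-- A block walk expansion of `K` is one of any kernel family agreeing with `K` on polydisc × ball (only `hasSum` sees the kernel).
[cite: Balaban1985BackgroundPropagators, Thm 3.10 (3.107) p.416] -/
theorem blockWalkExpansion_congr_kernel (h : BlockWalkExpansion c cub cubn K2 X R ε kap Kbar T2 SX A D ρ)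
    (heq : ∀ σ : TPt d N' → ℂ, (∀ j, ‖σ j‖ ≤ Real.exp c.κ₁) → ∀ u ∈ ball (0 : E) R, K2' σ u = K2 σ u) :
    BlockWalkExpansion c cub cubn K2' X R ε kap Kbar T2 SX A D ρ where
  hasSum σ hσ u hu i j := by rw [heq σ hσ u hu]; exact h.hasSum σ hσ u hu i j
  termAnalytic := h.termAnalytic
  majB := h.majB
  majSum := h.majSum
  indep := h.indep
  through := h.through
  A_nonneg := h.A_nonneg
  D_nonneg := h.D_nonneg

/-- **THE EXPANDED KERNEL HAS BLOCKS `≤ K̄e^{−κd₁}`** (block twin of `JointWalkExpansion.majorants`, NO fibre factor): the row mass of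
`K(σ,u)` inside a cube is below the sum over the terms of their row masses, each below the term's block majorant, whose partial sums
the shape bounds. [cite: Balaban1985BackgroundPropagators, (3.108) p.416; Balaban1988RG2Cluster, p.13, p.15] -/
theorem blockNorm_kernel_le (h : BlockWalkExpansion c cub cubn K2 X R ε kap Kbar T2 SX A D ρ) (hε : 0 ≤ ε) :
    ∀ σ : TPt d N' → ℂ, (∀ j, ‖σ j‖ ≤ Real.exp c.κ₁) → ∀ u ∈ ball (0 : E) R,
      ∀ y y', blockNorm cub cubn (K2 σ u) y y' ≤ Kbar * Real.exp (-(kap * tdist1 K y y')) := by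
  classical
  intro σ hσ u hu y y'
  -- the full-rate majorants and their partial sums
  have hfull : ∀ ω a b, A ω * Real.exp (-(ρ * D ω a b)) ≤ A ω * Real.exp (-((ρ - ε) * D ω a b)) := fun ω a b =>
    mul_le_mul_of_nonneg_left (Real.exp_le_exp.2 (by nlinarith [mul_nonneg hε (h.D_nonneg ω a b)])) (h.A_nonneg ω)
  have hpart : ∀ (S : Finset W) (a b : UT K), ∑ ω ∈ S, A ω * Real.exp (-(ρ * D ω a b)) ≤ Kbar * Real.exp (-(kap * tdist1 K a b)) :=
    fun S a b => (Finset.sum_le_sum fun ω _ => hfull ω a b).trans (h.majSum S a b)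
  have hK0 : 0 ≤ Kbar * Real.exp (-(kap * tdist1 K y y')) := by simpa using hpart ∅ y y'
  refine blockNorm_le_of_rowMass_le cub cubn (K2 σ u) y y' hK0 fun i hi => ?_
  -- summability of the entry norms of the terms, by comparison with the block majorants
  have hmaj : ∀ ω j, ‖T2 ω σ u i j‖ ≤ A ω * Real.exp (-(ρ * D ω (cub i) (cubn j))) := fun ω j =>
    (norm_entry_le_blockNorm cub cubn (T2 ω σ u) i j).trans (h.majB ω σ hσ u hu (cub i) (cubn j))
  have hmsum : ∀ j, Summable fun ω => A ω * Real.exp (-(ρ * D ω (cub i) (cubn j))) := fun j =>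
    summable_of_sum_le (fun ω => mul_nonneg (h.A_nonneg ω) (Real.exp_nonneg _)) fun S => hpart S (cub i) (cubn j)
  have hsum : ∀ j, Summable fun ω => ‖T2 ω σ u i j‖ := fun j =>
    (hmsum j).of_nonneg_of_le (fun ω => norm_nonneg _) (fun ω => hmaj ω j)
  -- each entry of the kernel is below the sum of the entry norms of the terms
  have hentry : ∀ j, ‖K2 σ u i j‖ ≤ ∑' ω, ‖T2 ω σ u i j‖ := fun j =>
    (h.hasSum σ hσ u hu i j).norm_le_of_bounded (hsum j).hasSum fun ω => le_rfl
  -- partial sums of the row masses of the terms inside the cube `y′`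
  have hrow : ∀ S : Finset W, ∑ ω ∈ S, ∑ j ∈ Finset.univ.filter (fun j => cubn j = y'), ‖T2 ω σ u i j‖ ≤
      Kbar * Real.exp (-(kap * tdist1 K y y')) := fun S => by
    calc ∑ ω ∈ S, ∑ j ∈ Finset.univ.filter (fun j => cubn j = y'), ‖T2 ω σ u i j‖
        = ∑ ω ∈ S, rowMass cubn (T2 ω σ u) i y' := rfl
      _ ≤ ∑ ω ∈ S, blockNorm cub cubn (T2 ω σ u) y y' :=
          Finset.sum_le_sum fun ω _ => by simpa [hi] using rowMass_le_blockNorm cub cubn (T2 ω σ u) i y'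
      _ ≤ ∑ ω ∈ S, A ω * Real.exp (-(ρ * D ω y y')) := Finset.sum_le_sum fun ω _ => h.majB ω σ hσ u hu y y'
      _ ≤ Kbar * Real.exp (-(kap * tdist1 K y y')) := hpart S y y'
  have hsumrow : Summable fun ω => ∑ j ∈ Finset.univ.filter (fun j => cubn j = y'), ‖T2 ω σ u i j‖ :=
    summable_sum fun j _ => hsum j
  calc rowMass cubn (K2 σ u) i y' = ∑ j ∈ Finset.univ.filter (fun j => cubn j = y'), ‖K2 σ u i j‖ := rfl
    _ ≤ ∑ j ∈ Finset.univ.filter (fun j => cubn j = y'), ∑' ω, ‖T2 ω σ u i j‖ := Finset.sum_le_sum fun j _ => hentry j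
    _ = ∑' ω, ∑ j ∈ Finset.univ.filter (fun j => cubn j = y'), ‖T2 ω σ u i j‖ := (Summable.tsum_finsetSum fun j _ => hsum j).symm
    _ ≤ Kbar * Real.exp (-(kap * tdist1 K y y')) := hsumrow.tsum_le_of_sum_le hrow

end Projections

/-! ## §2. A σ-independent holomorphic family with ONE decaying block letter is its own one-term expansion -/

section Single

/-- One-term majorant families on `Unit` (cf. `Gaps/D4WalkBlockGlue`). -/
private theorem majSumLe_unit {g : B6.Geometry} {K₀ Kbar : g.Site → g.Site → ℝ} (hK : ∀ a b, 0 ≤ K₀ a b)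
    (hle : ∀ a b, K₀ a b ≤ Kbar a b) : MajSumLe (fun (_ : Unit) a b => K₀ a b) Kbar := by
  intro S a b
  calc ∑ _ω ∈ S, K₀ a b ≤ ∑ _ω ∈ (Finset.univ : Finset Unit), K₀ a b :=
        Finset.sum_le_sum_of_subset_of_nonneg (Finset.subset_univ S) fun _ _ _ => hK a b
    _ = K₀ a b := by simp
    _ ≤ Kbar a b := hle a b

/-- **THE TAIL AS A ONE-TERM BLOCK WALK EXPANSION**: a σ-independent family `V(u)`, entrywise holomorphic on the ball, with the
decaying block letter `‖V(u)‖_{y,y′} ≤ λ_Ve^{−ρ_Vd₁(y,y′)}`, is a `BlockWalkExpansion` with `W = Unit`, no σ-carrying term, walk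
distance `d₁`, walk rate `ρ_V`, any window `ε` and any torus rate `κ ≤ ρ_V − ε`, constant `λ_V` (the shape of [B9] (3.48)'s tail
read in the (3.108) currency). [cite: Balaban1985BackgroundPropagators, Thm 3.2 (3.48) p.398, (3.108) p.416] -/
theorem blockWalkExpansion_single (c : B13.Consts) (cubn : n → UT K) (X : Finset (UT K)) {V : E → Matrix n n ℂ}
    {R ε κ lamV ρV : ℝ} (hlam : 0 ≤ lamV) (hκ : κ ≤ ρV - ε)
    (hVan : ∀ i j, DifferentiableOn ℂ (fun u => V u i j) (ball (0 : E) R))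
    (hVbd : ∀ u ∈ ball (0 : E) R, ∀ y y', blockNorm cubn cubn (V u) y y' ≤ lamV * Real.exp (-(ρV * tdist1 K y y'))) :
    BlockWalkExpansion c cubn cubn (fun (_ : TPt d N' → ℂ) u => V u) X R ε κ lamV
      (fun (_ : Unit) (_ : TPt d N' → ℂ) u => V u) (∅ : Set Unit) (fun _ => lamV) (fun _ => tdist1 K) ρV where
  hasSum σ _ u _ i j := hasSum_unique (fun _ : Unit => V u i j)
  termAnalytic _ σ _ i j := hVan i j
  majB _ σ _ u hu y y' := hVbd u hu y y'
  majSum := majSumLe_unit (fun a b => mul_nonneg hlam (Real.exp_nonneg _)) fun a b =>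
    mul_le_mul_of_nonneg_left (Real.exp_le_exp.2 (by nlinarith [tdist1_nonneg a b])) hlam
  indep _ _ σ _ := rfl
  through ω hω := by simp at hω
  A_nonneg _ := hlam
  D_nonneg _ a b := tdist1_nonneg a b

end Single

/-! ## §3. THE STEP: `W ↦ W·(1 + V·W)⁻¹` is a block walk expansion, margin `O(λ_V)` -/

section Tail

variable [DecidableEq n]
variable {c₀ : B13.Consts} {cubn : n → UT K} {X : Finset (UT K)}
variable {K2 : (TPt d N' → ℂ) → E → Matrix n n ℂ} {W₀ : Type} {T2 : W₀ → (TPt d N' → ℂ) → E → Matrix n n ℂ}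
variable {SX : Set W₀} {A : W₀ → ℝ} {D : W₀ → UT K → UT K → ℝ}
variable {V2 : (TPt d N' → ℂ) → E → Matrix n n ℂ} {WV : Type} {TV : WV → (TPt d N' → ℂ) → E → Matrix n n ℂ}
variable {SXV : Set WV} {AV : WV → ℝ} {DV : WV → UT K → UT K → ℝ}
variable {V : E → Matrix n n ℂ}
variable {R εW κW KbarW ρW εV κV KbarV lamV ρV μ cμ : ℝ}

/-- **A BLOCK WALK EXPANSION SURVIVES A BLOCK-WALK-EXPANDED PERTURBATION OF THE OPERATOR** (general form: the perturbation
`V(σ,u)` may itself be s-decorated — print decorates EVERY term, [II] p. 3 ∕ (1.11)).  Data: a block walk expansion of `W(σ,u)` at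
`(ε_W, κ_W, K̄_W, ρ_W)` and one of `V(σ,u)` at `(ε_V, κ_V, K̄_V, ρ_V)`, both with dominating distances, nested as `ρ_W + μ ≤ ρ_V`,
`ρ_V − ε_V ≤ ρ_W − ε_W`, `κ_W + μ ≤ κ_V`; the cube row sum `(μ, c_μ)`; `0 ≤ μ`, `2μ ≤ ε_W`, `2μ ≤ κ_W`, `κ_W + μ ≤ ρ_W − ε_W`; MARGIN
`q = c_μ(c_μ·1·(1·(c_μK̄_VK̄_Wc_μ))c_μ)c_μ < 1`.  Then `W(σ,u)·(1 + V(σ,u)W(σ,u))⁻¹` is a block walk expansion at `(ε_W − 2μ, κ_W − 2μ)`,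
walk rate `ρ_W − 2μ`, constant `c_μK̄_W(1−q)⁻¹c_μ`, dominating distances, σ-carrying terms = those with a σ-carrying factor.  Composition
BY NAME: `blockWalkExpansion_mul` → `blockWalkExpansion_inv_pencil` (seed `blockWalkExpansion_one`, `t = 1`) → `blockWalkExpansion_mul`
— print's (3.96) ∕ (3.130) step «replace each operator in (3.130) by its random walk expansion».
[cite: Balaban1985BackgroundPropagators, (3.92)–(3.94) p.410, (3.95)–(3.96) p.411, (3.107)–(3.108) p.416, (3.130) p.421, p.422; Balaban1988RG2Cluster, p.3, (1.11) p.5, p.13, p.15] -/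
theorem blockWalkExpansion_tail_bwe
    (hW : BlockWalkExpansion c₀ cubn cubn K2 X R εW κW KbarW T2 SX A D ρW)
    (hdom : ∀ ω, DomBy (toB6 (torusGeom K 0 0 0) 0 True) (D ω))
    (hV : BlockWalkExpansion c₀ cubn cubn V2 X R εV κV KbarV TV SXV AV DV ρV)
    (hVdom : ∀ ω, DomBy (toB6 (torusGeom K 0 0 0) 0 True) (DV ω))
    (hμ : 0 ≤ μ) (hμε : 2 * μ ≤ εW) (hμκ : 2 * μ ≤ κW) (hwin : κW + μ ≤ ρW - εW)
    (hρV : ρW + μ ≤ ρV) (hwV : ρV - εV ≤ ρW - εW) (hκV : κW + μ ≤ κV) (hKbarV : 0 ≤ KbarV)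
    (hKbar : 0 ≤ KbarW) (hcμ : 0 ≤ cμ) (hrow : RowSum (toB6 (torusGeom K 0 0 0) 0 True) μ cμ)
    (hq : cμ * (cμ * 1 * (1 * (cμ * KbarV * KbarW * cμ)) * cμ) * cμ < 1) :
    ∃ (W : Type) (T : W → (TPt d N' → ℂ) → E → Matrix n n ℂ) (SX' : Set W) (A' : W → ℝ) (D' : W → UT K → UT K → ℝ),
      BlockWalkExpansion c₀ cubn cubn (fun σ u => K2 σ u * (1 + V2 σ u * K2 σ u)⁻¹) X R (εW - 2 * μ) (κW - 2 * μ)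
        (cμ * KbarW * (1 * (1 - cμ * (cμ * 1 * (1 * (cμ * KbarV * KbarW * cμ)) * cμ) * cμ)⁻¹) * cμ) T SX' A' D' (ρW - 2 * μ) ∧
      ∀ ω, DomBy (toB6 (torusGeom K 0 0 0) 0 True) (D' ω) := by
  have hεW : 0 ≤ εW := by linarith
  have hκW : 0 ≤ κW := by linarith
  have hρW : εW ≤ ρW := by linarith
  -- (ii) P = V·W at W's own rates (the perturbation pays the product's rate loss: ρ_V ≥ ρ_W + μ)
  have hP := blockWalkExpansion_mul (ρ := ρW) (ε := εW) (κ := κW) hV hW hVdom hdom hrow hrow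
    (by linarith) le_rfl hμ hρV hεW hwV le_rfl hKbarV hKbar hκW le_rfl hκV hcμ
  have hPdom : ∀ ω : WV × W₀, DomBy (toB6 (torusGeom K 0 0 0) 0 True)
      (infConv (g := toB6 (torusGeom K 0 0 0) 0 True) (DV ω.1) (D ω.2)) := fun ω => domBy_infConv_torus (hVdom ω.1) (hdom ω.2)
  -- (iii) N = (1 + P)⁻¹ by the Neumann step from the identity seed
  have hone := blockWalkExpansion_one (d := d) (N' := N') (E := E) c₀ cubn X R εW (ρW - εW)
  have hN := blockWalkExpansion_inv_pencil (A := fun (_ : TPt d N' → ℂ) (_ : E) => (1 : Matrix n n ℂ))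
    (t := (1 : ℂ)) (τ := 1) (ρ := ρW - 2 * μ) (ε := εW - 2 * μ) (ρs := ρW - μ) (κs := κW - μ) (κ := κW - 2 * μ)
    hone hP (fun _ a b => le_rfl) hPdom (fun σ₀ _ u _ => Matrix.one_mul _) hrow hrow hμ hμ hcμ hcμ
    (by linarith) (by linarith) (by linarith) (by linarith) (by linarith) (by linarith) (by linarith) zero_le_one (by positivity)
    (by linarith) (by linarith) (by linarith) (by linarith) (by linarith) (by linarith) zero_le_one (by simp) hq
  have hq1 : 0 < 1 - cμ * (cμ * 1 * (1 * (cμ * KbarV * KbarW * cμ)) * cμ) * cμ := by linarith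
  have hNdom : ∀ ω : List (Unit × (WV × W₀)) × Unit, DomBy (toB6 (torusGeom K 0 0 0) 0 True)
      (chainDist (g := toB6 (torusGeom K 0 0 0) 0 True)
        (fun i : Unit × (WV × W₀) => infConv (g := toB6 (torusGeom K 0 0 0) 0 True) (tdist1 K)
          (infConv (g := toB6 (torusGeom K 0 0 0) 0 True) (DV i.2.1) (D i.2.2))) (tdist1 K) ω.1) :=
    fun ω => domBy_chain (DC := fun _ : Unit => tdist1 K) (fun _ a b => le_rfl) hPdom ω
  -- (iv) W·N
  have hK := blockWalkExpansion_mul (ρ := ρW - 2 * μ) (ε := εW - 2 * μ) (κ := κW - 2 * μ) hW hN hdom hNdom hrow hrow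
    (by linarith) le_rfl hμ (by linarith) (by linarith) (by linarith) (by linarith) hKbar (by positivity)
    (by linarith) le_rfl (by linarith) hcμ
  refine ⟨_, _, _, _, _, blockWalkExpansion_congr_kernel hK fun σ _ u _ => ?_,
    fun ω => domBy_infConv_torus (hdom ω.1) (hNdom ω.2)⟩
  simp only [one_smul]

/-- **A BLOCK WALK EXPANSION SURVIVES AN EXPONENTIALLY-TAILED PERTURBATION OF THE OPERATOR** (σ-independent tail; print's own
undecorated use is the plaquette-local `Δ′_π` of (3.130)).  Data: a block walk expansion of the family `W(σ,u)` at window `ε_W`, torus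
rate `κ_W`, constant `K̄_W`, walk rate `ρ_W`, with dominating walk distances; a σ-independent tail `V(u)`, entrywise holomorphic, with
the block letter `λ_Ve^{−ρ_Vd₁}` at a rate `ρ_V ≥ ρ_W + μ`; the cube row sum `(μ, c_μ)`; rates `0 ≤ μ`, `2μ ≤ ε_W`, `2μ ≤ κ_W`,
`κ_W + μ ≤ ρ_W − ε_W`; and the MARGIN `q = c_μ(c_μ·1·(1·(c_μλ_VK̄_Wc_μ))c_μ)c_μ < 1` — the tail is small.  Then
`W(σ,u)·(1 + V(u)W(σ,u))⁻¹` is a block walk expansion at `(ε_W − 2μ, κ_W − 2μ)`, walk rate `ρ_W − 2μ`, constant `c_μK̄_W(1−q)⁻¹c_μ`,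
dominating distances (= `blockWalkExpansion_tail_bwe` ∘ §2). [cite: Balaban1985BackgroundPropagators, Thm 3.2 (3.48) p.398, (3.92)–(3.94) p.410, (3.95)–(3.96) p.411, (3.107)–(3.108) p.416, (3.130) p.421, p.422; Balaban1988RG2Cluster, (1.11) p.5, p.13, p.15] -/
theorem blockWalkExpansion_tail
    (hW : BlockWalkExpansion c₀ cubn cubn K2 X R εW κW KbarW T2 SX A D ρW)
    (hdom : ∀ ω, DomBy (toB6 (torusGeom K 0 0 0) 0 True) (D ω))
    (hlam : 0 ≤ lamV) (hVan : ∀ i j, DifferentiableOn ℂ (fun u => V u i j) (ball (0 : E) R))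
    (hVbd : ∀ u ∈ ball (0 : E) R, ∀ y y', blockNorm cubn cubn (V u) y y' ≤ lamV * Real.exp (-(ρV * tdist1 K y y')))
    (hμ : 0 ≤ μ) (hμε : 2 * μ ≤ εW) (hμκ : 2 * μ ≤ κW) (hwin : κW + μ ≤ ρW - εW) (hρV : ρW + μ ≤ ρV)
    (hKbar : 0 ≤ KbarW) (hcμ : 0 ≤ cμ) (hrow : RowSum (toB6 (torusGeom K 0 0 0) 0 True) μ cμ)
    (hq : cμ * (cμ * 1 * (1 * (cμ * lamV * KbarW * cμ)) * cμ) * cμ < 1) :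
    ∃ (W : Type) (T : W → (TPt d N' → ℂ) → E → Matrix n n ℂ) (SX' : Set W) (A' : W → ℝ) (D' : W → UT K → UT K → ℝ),
      BlockWalkExpansion c₀ cubn cubn (fun σ u => K2 σ u * (1 + V u * K2 σ u)⁻¹) X R (εW - 2 * μ) (κW - 2 * μ)
        (cμ * KbarW * (1 * (1 - cμ * (cμ * 1 * (1 * (cμ * lamV * KbarW * cμ)) * cμ) * cμ)⁻¹) * cμ) T SX' A' D' (ρW - 2 * μ) ∧
      ∀ ω, DomBy (toB6 (torusGeom K 0 0 0) 0 True) (D' ω) :=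
  -- the tail as a one-term expansion at window `ρ_V − ρ_W + ε_W`, torus rate `ρ_W − ε_W`, then the general step
  blockWalkExpansion_tail_bwe (V2 := fun (_ : TPt d N' → ℂ) u => V u) hW hdom
    (blockWalkExpansion_single (d := d) (N' := N') c₀ cubn X (ε := ρV - ρW + εW) (κ := ρW - εW) hlam (by linarith) hVan hVbd)
    (fun _ a b => le_rfl) hμ hμε hμκ hwin hρV (by linarith) (by linarith) hlam hKbar hcμ hrow hq

end Tail

/-! ## §4. At `s ≡ 1` the new kernel is `(A + V)⁻¹` -/

section KernelOne

variable [DecidableEq n]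

/-- **`W(A + V)`-RESUMMATION AT `s ≡ 1`**: if `A·W = 1` (so `W = A⁻¹`) and `1 + V·W` is a unit, then `W·(1 + V·W)⁻¹ = (A + V)⁻¹` —
for the seat's ENDs `W(1,u) = (1 + K′_{≤r₁}(u))⁻¹`, so the tail-corrected kernel at `s ≡ 1` is `Δ′(u)⁻¹` with
`Δ′ = 1 + K′_{≤r₁} + K′_tail` (print: `G = G₀Σ(−Δ′_πG₀)ⁿ` resummed). [cite: Balaban1985BackgroundPropagators, (3.96) p.411, (3.130) p.421, (3.88)–(3.90) p.409] -/
theorem tail_kernel_one (A W V : Matrix n n ℂ) (hAW : A * W = 1) (hunit : IsUnit (1 + V * W).det) :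
    W * (1 + V * W)⁻¹ = (A + V)⁻¹ := by
  symm
  refine Matrix.inv_eq_right_inv ?_
  calc (A + V) * (W * (1 + V * W)⁻¹) = (A * W + V * W) * (1 + V * W)⁻¹ := by rw [← Matrix.mul_assoc, Matrix.add_mul]
    _ = (1 + V * W) * (1 + V * W)⁻¹ := by rw [hAW]
    _ = 1 := Matrix.mul_nonsing_inv _ hunit

omit [NormedSpace ℂ E] in
/-- The family form of `tail_kernel_one` on the ball. [cite: Balaban1985BackgroundPropagators, (3.130) p.421] -/
theorem tail_kernel_one_family {K2 : (TPt d N' → ℂ) → E → Matrix n n ℂ} {Aop V : E → Matrix n n ℂ} {R : ℝ}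
    (hAW : ∀ u ∈ ball (0 : E) R, Aop u * K2 (fun _ => 1) u = 1)
    (hunit : ∀ u ∈ ball (0 : E) R, IsUnit (1 + V u * K2 (fun _ => 1) u).det) :
    ∀ u ∈ ball (0 : E) R, K2 (fun _ => 1) u * (1 + V u * K2 (fun _ => 1) u)⁻¹ = (Aop u + V u)⁻¹ :=
  fun u hu => tail_kernel_one (Aop u) (K2 (fun _ => 1) u) (V u) (hAW u hu) (hunit u hu)

end KernelOne

end Summit.QuantumFields.BalabanUV.Gaps.D4WalkBlockTail

end
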